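import Mathlib
import HarnessLib
import HarnessLib.Audit
import Summits.ResolutionOfSingularities.Statement
import HarnessLib.Audit.Status.Attr

/-!
Route: WildCones

# Route WildCones — wild cones cannot hide — p | ν forces singular directions, so isolated
height-one chains die; steer the rest

BARRIER-INVERSION route (operator C, third reading of the catalogue). Every catalogued obstruction
of this summit lives in the UNFORCED or
NON-CLOSED regime: Hauser–Perlega's divergent runs choose point centres where positive-dimensional
permissible centres exist
(ResidualOrderUnbounded, KangarooShadeIncrease), Hironaka's quadric needs a 2-independent pair in an
IMPERFECT residue field of a non-closed
point (DirectrixSmallCharacteristic), Narasimhan's top locus is a curve (NarasimhanMaximalContact),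
Cossart–Piltant's ω-rise happens under a
positive-dimensional permissible centre (DimensionFourFrontier), defect lives in immediate
extensions (LocalMonomializationFails,
ArtinSchreierPuiseux). So ANY successful route must (a) separate the FORCED regime (isolated closed
points of multiplicity p over perfect
fields, where the centre is the point) from the unforced one, (b) decide the forced regime by a
mechanism that tracks NO order-type
invariant and chooses NO hypersurface of contact, and (c) push everything else through statements
typed over perfect fields plus the
shared descent. It suffices to show X = ConeExit ∧ NarrowRunsDie ∧ ClassicalRegimes (the ENGINE,
new) ∧ Steer ∧ TorsorToLurelPerfect ∧
PatchingRelPerfect ∧ DescentPerfectToAll (the steering chain, shared verbatim with route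
FrobeniusClosing: stmt-16345/16162/16161/0549).
The engine proves the TARGET IsolatedForcedTermination (stmt-16343, FrobeniusClosing's target,
verbatim: no infinite run of the
point-blow-up dynamics of a height-one atom z^p = a(u_1..u_n) over a perfect field has all states
isolated of multiplicity p) by the
mechanism of card wild-cones-cannot-hide (critic grade new-mechanism, unrouted until now): because p
divides the multiplicity, Euler's
identity degenerates, the gradient of the tangent cone descends to a section of Ω¹_{P^{s'-1}}(p)
with non-zero top Chern class (p odd),
so a wild cone always has a critical direction and the singular locus of the blow-up through every
near point is positive-dimensional
unless the cone-invariance space L has dimension exactly 1 (ConeExit, one step, finitely refutable);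
d = 1 runs have a unique, forced near
point at every stage and can only recur freely, and an infinite free run of p-fold points is a
formal arc inside the p-fold locus,
contradicting isolatedness (NarrowRunsDie); p = 2 (contact-form exception of the Chern lemma:
hyperbolic pairs split, card
morse-mod-squares) and n ≤ 2 (Lipman / plane curves) are the classical regimes (ClassicalRegimes).
Lean: `ConeExit ∧ NarrowRunsDie ∧ ClassicalRegimes ∧ Steer ∧ TorsorToLurelPerfect ∧
PatchingRelPerfect ∧ DescentPerfectToAll`

## Assembly
Pure logic, certified sorry-free (Sketch.lean = glue.lean: lean check rc 0, 0 sorries, `closes`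
axioms propext · Classical.choice ·
Quot.sound). The ENGINE `engine : ConeExit → NarrowRunsDie → ClassicalRegimes →
IsolatedForcedTermination` is proved in the glue file by a
case split `n ≤ 2 ∨ p = 2` (→ ClassicalRegimes) and otherwise `fun hall => hN … hall (fun m => hC …
(run m) (i m) (t m) (hall m) (hall (m+1)))`
— the one-step lemma applied along the run; the dynamics is the SAME `let`-bound coefficient
calculus in every item (FrobeniusClosing's,
verbatim), so `run (m+1) ≡ step (i m) (t m) (run m)` holds by ζ/ι-reduction and the chain
type-checks with no lemma. Then, at a prime p,
Steer turns the target into TorsorLUPerfect's body, TorsorToLurelPerfect gives relative LU over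
perfect k, PatchingRelPerfect resolution over
perfect k, DescentPerfectToAll ResolutionInChar p:
`closes hN hC hS hR hP hT hD := fun p hp => hD p hp (hP p hp (hT p hp (hS (engine hC hN hR) p hp)))`
— every crux is used; the two supports
and the Assembly item are outside the deciding chain. The route file needs only Mathlib and the
Statement (no Literature module, no unproved
named fact in the cone).

Rationale: WHY THIS LINE. The same arithmetic that kills maximal contact (Kollar2007 Rem. 2.57, Lemma 3.74:
Euler/Tschirnhaus need p ∤ m) is turned into the
resource: for a form G of degree ν with p | ν, Σ y_i ∂_i G = νG = 0, so (∂_i G) lifts through the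
Euler sequence to a section of
Ω¹_{P^{s-1}}(ν) whose top Chern class ((ν−1)^s + (−1)^{s−1})/ν vanishes only for the contact form (ν
= 2, s even) — the one fact imported,
from the theory of Pfaff forms on projective space (Jouanolou, LNM 708, Ch. 1;
doi:10.1007/BFb0063393) and never before pointed at the
projectivised tangent cone of a wild singularity (Hironaka doi:10.4134/jkms.2003.40.5.901,
Giraud1975, CossartJannsenSaito2020 Thm 3.14
confine near points to P(Dir) but force nothing). It answers Hauser–Perlega's printed question
(arXiv:1802.05010 §1: no example 'where the
choice of point centers is forced (e.g. because the singularities are isolated)' could be built)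
with a theorem-shaped NEVER for height-one
atoms, and it does so with no residual order, no shade, no cleaning ambiguity (∇ kills p-th powers)
and no hypersurface of contact. Relative
to the 20 open routes: FrobeniusClosing (opened today) reaches the same target by a CERTIFICATE
(closing lemma + finite-field cycle search +
bounded Milnor number); this route reaches it by a PROOF MECHANISM (cone geometry + arc lemma) and
shares only the downstream steering chain
— an alternative decomposition of the shared node, not a restatement; no other route (Valuative,
ShadowGame, CyclicCovers, IndSmooth,
WeightedInvariant, MarkedTransfer, HomologicalConductor, VerticalModels …) has a forced/unforced
split or uses intersection theory on a
tangent cone. The engine is barrier-free by construction (perfect residue fields, closed points,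
point centres forced), so the whole bet of
the line is concentrated, visibly, in Steer.

RANKED CRUXES. #0 IsolatedForcedTermination (target) — (= FrobeniusClosing stmt-16343 verbatim) for
every prime p, n ≥ 1 and perfect field κ of characteristic p, no start coefficient function c₀ of
a(u) ∈ κ[[u_1..u_n]], chart word i and translation word t make every state of the point-blow-up
dynamics (blow up the closed point, divide z^p = a by u_i^p, translate to the new closed point,
delete p-th-power monomials) isolated (κ[[u]]/(∂a) finite) of multiplicity p (cleaned order ≥ p).
Derived inside `closes` as `engine hC hN hR`. (why it might fail: an honest infinite chain of
isolated p-fold infinitely near points of a height-one atom — Hauser–Perlega's missing forced cycle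
— refutes it; unknown for p ≥ 3, n ≥ 4.) [arXiv:1802.05010, HauserPerlega2019, arXiv:1412.0868,
BoubakriGreuelMarkwig2010]
#2 NarrowRunsDie (crux) — NARROW RUNS DIE (card K1, d = 1 branch): for p odd and n ≥ 3, there is no
infinite run of the dynamics all of whose states are isolated of multiplicity p, of cleaned order
EXACTLY p, with one-dimensional cone-invariance space L(a_p) = {w : a_p(X + wS) = a_p(X) + a_p(w)
S^p} (dL = 1). Mechanism: d = 1 makes the near point unique and FORCED at every stage; a satellite
near point would need a direction in L/⟨v⟩ = 0, so recurrence is free; an infinite free run of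
p-fold points consists of the infinitely near points of one smooth formal arc γ, and then z^p + a ∈
I_γ^p (arc lemma), so γ ⊂ Sing — the start was not isolated. [difficulty: L] (why it might fail: the
satellite-exclusion step (next near direction never tangent to an old exceptional component when d =
1) is only sketched in dimension ≥ 3; a tangential d = 1 recurrence with growing higher Taylor data
would be a genuine forced kangaroo and refute the crux (and the target).) [arXiv:1802.05010,
doi:10.4134/jkms.2003.40.5.901, CossartJannsenSaito2020, Kollar2007]
#3 ConeExit (crux) — ONE-STEP CONE EXIT LEMMA (card P3 + Chern forcing, typed one blow-up at a time,
finitely refutable): p odd, n ≥ 3, κ perfect of char p; if a state c (coefficients of a(u)) is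
isolated of multiplicity p and some successor step i τ c (chart i, translation τ) is again isolated
of multiplicity p, then c has cleaned order EXACTLY p and dL c = 1. Content: cleaned order > p ⇒
every successor is non-isolated or of order < p (Sing(X') ∩ E ⊇ {z' = 0, a_{m}(v) = 0}, dimension ≥
n − 2 ≥ 1); order p and d = dim L ≥ 2 ⇒ gradient-invariance space M has m ≥ d + 1 ≥ 3, the Chern
lemma gives a critical direction q of the cone modulo M, G|_N is a p-th power on N = M ⊕ ⟨q⟩, and
Sing(X') ∩ E ⊇ P(N) ∩ {Θ_N = 0} ∩ {a_{p+1} = 0} has components of dimension ≥ m − 2 ≥ 1 through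
every near point; d = 0 ⇒ no near point. [difficulty: M] (why it might fail: at p = 2 it IS false (a
= u1u2 + u3²u4 + u4⁵ + u3⁷, n = 4: isolated double successor at e3 with d = 2 — contact-form
exception), hence p ≠ 2; for odd p the containment Sing(X') ⊇ P(N) ∩ {Θ_N = a_(p+1) = 0} through
EVERY near point is checked on families only (p = 3, n = 4: 8/8).) [doi:10.1007/BFb0063393,
Hironaka1970AdditiveGroups, CossartJannsenSaito2020, Kollar2007, arXiv:1802.05010]
#4 Steer (crux) — (= FrobeniusClosing stmt-16345 verbatim) STEERING: IsolatedForcedTermination ⇒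
local uniformization of α_p-torsors t^p ∈ A₀ over bases regular at the centre, along every
valuation, over every PERFECT field (the body of TorsorLUPerfect inlined). At unforced stages a
positive-dimensional permissible centre exists; this route's intended engine for it is 'blow up what
the cone forces' — the cone-forced singular locus P(N) ∩ {Θ_N = 0} ∩ {a_(p+1) = 0} of ConeExit as
canonical centre — where FrobeniusClosing proposes CP-style maximal coordinate strata; the item is
rule-free and shared. [deps: ConeExit, NarrowRunsDie, ClassicalRegimes] [difficulty: open-problem]
(why it might fail: the unforced regime may carry the whole difficulty (CossartPiltant2019 Rem. 3.2:
ω rises under a permissible centre at n = 4; HP's cycles are unforced): then forced termination buys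
nothing and Steer is LuAlphaPTorsor (stmt-0641) again.) [arXiv:1412.0868, arXiv:1802.05010,
CutkoskyMourtada2019, NovacoskiSpivakovsky2014, Temkin2013,
Literature.Barriers.ResolutionOfSingularities.DimensionFourFrontier]
#5 ClassicalRegimes (crux) — CLASSICAL REGIMES: the target restricted to (n ≤ 2) ∨ (p = 2). n = 1:
point blow-ups of the plane curve z^p + a(u) exit multiplicity p (multiplicity sequences). n = 2:
every state of an isolated chain is the local ring of Lipman's NORMALISED blow-up (an isolated
hypersurface point is normal), so an infinite chain contradicts Lipman1978. p = 2, n ≥ 3: a cleaned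
state of order 2 has non-zero alternating polar form, a hyperbolic pair splits off over κ[[u]]
(Morse modulo squares, card morse-mod-squares; Greuel–Kröning doi:10.1007/bf02570742, Greuel–Pfister
doi:10.1016/j.jalgebra.2025.10.023), the dynamics of z² + u1u2 + g(u'') is the suspended dynamics of
z² + g(u''), and induction on n ends in n ≤ 2; cleaned order > 2 exits by the Case-A argument of
ConeExit (char-free). [difficulty: M] (why it might fail: p = 2 needs hyperbolic splitting to
commute with the blow-up/cleaning dynamics at every stage and keep isolatedness (translation may
un-split the quadratic part); n = 2 needs the dictionary state ↦ local ring of the strict transform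
to be exact (u_i^p divided only at cleaned order ≥ p).) [Lipman1978, doi:10.1007/bf02570742,
doi:10.1016/j.jalgebra.2025.10.023, Kollar2007, CossartJannsenSaito2020]
#6 PatchingRelPerfect (crux) — (= stmt-16161 verbatim, shared with ShadowGame / FrobeniusClosing)
Zariski patching over PERFECT ground fields: relative local uniformization for all f.g. K/k, k
perfect of char p ⇒ every reduced separated finite-type scheme over every perfect field of char p
has a resolution. [difficulty: open-problem] (why it might fail: patching local uniformizations into
one proper regular model is known only in dim ≤ 3 (Zariski; CossartPiltant2008 Prop 4.9 /
Piltant2013 need embedded resolution one dimension down); in dim ≥ 4 no reduction Res ⇐ LU exists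
even in char 0 (CutkoskyMourtada2019 p. 3).) [CutkoskyMourtada2019, Temkin2013, CossartPiltant2019,
NovacoskiSpivakovsky2014, Literature.Barriers.ResolutionOfSingularities.DimensionFourFrontier]
#7 TorsorToLurelPerfect (crux) — (= stmt-16162 verbatim, shared) Temkin's inseparable reduction over
PERFECT ground fields: LU of α_p-torsors over bases regular at the centre ⇒ relative LU for every
f.g. K/k, k perfect of char p (Temkin2013 Thm 1.3.2 + Frobenius transport + the degree-p radical
tower). [deps: Steer] [difficulty: L] (why it might fail: rests on Temkin2013 Thm 1.3.2 (vendored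
fact with an unproved leaf in tree, Temkin2013RelativeCurveSmoothFibre) and on Temkin's model
dominating the GIVEN R (relative form); smooth ≠ regular bookkeeping at each tower step.)
[Temkin2013, arXiv:0804.1554, Literature.AlgebraicGeometry.Resolution.Temkin2013Relative,
Literature.Barriers.ResolutionOfSingularities.InseparableBaseChange]
#8 DescentPerfectToAll (crux) — (= stmt-0549 verbatim, shared with Descent / WeightedInvariant /
UniformComplexity / CleanCovers / MarkedTransfer / ShadowGame / UniversalCells / FrobeniusClosing /
EquisingularLift / IndSmooth) resolution of all reduced separated finite-type schemes over all
PERFECT fields of char p ⇒ ResolutionInChar p. [difficulty: open-problem] (why it might fail: only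
known mechanism spreads X over a f.g. field of definition and base-changes a resolution over a
perfect subfield back; regular is not geometrically regular under inseparable extension (EGA IV
6.7.4), e.g. k = F_p((t)) (Temkin2008 Question 3.3.3 open).) [arXiv:math/0703678, Kollar2007,
Literature.Barriers.ResolutionOfSingularities.InseparableBaseChange,
Literature.Barriers.ResolutionOfSingularities.RegularNotGeometricallyRegular]
#9 ChernCriticalDirection (support) — CHERN LEMMA (card P1, provable now; the existence lemma
ConeExit consumes): for p odd, s ≥ 2 and k algebraically closed of characteristic p, every non-zero
form H of degree p in s variables has a point v ≠ 0 of k^s at which all partial derivatives ∂_j H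
vanish ((∂_j H) is a section of Ω¹_(P^(s−1))(p) by Euler degeneracy; c_(s−1) = ((p−1)^s +
(−1)^(s−1))/p ≠ 0; elementary for s = 2: H_1 = y_2 Q, H_2 = −y_1 Q, deg Q = p − 2 ≥ 1). [difficulty:
provable-now] [doi:10.1007/BFb0063393, Kollar2007]
#9 TorsorLUPerfect (support) — (= stmt-16158 verbatim, ShadowGame's target / Valuative's
LuAlphaPTorsor with [PerfectField k]) local uniformization of α_p-torsors over bases regular at the
centre, over PERFECT ground fields — the consequent of Steer and the antecedent of
TorsorToLurelPerfect (inlined there); listed so the shared item carries this route too. [difficulty: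
open-problem] [Temkin2013, CutkoskyMourtada2019, CossartPiltant2019,
Literature.Barriers.ResolutionOfSingularities.DimensionFourFrontier]

TWO-LAYER PLAN. Foreseen glued splits, filed only after a census: NarrowRunsDie ⇐ SatelliteExclusion
(d = 1 ⇒ the next near direction is transversal to
every older exceptional component: L' ∩ T(E_old) = 0) → FreeRunArc (an infinite free isolated p-fold
run lies on one smooth formal arc γ with
z^p + a ∈ I_γ^p: the arc lemma, monomial bookkeeping ord f(x, x^i u)/x^(iν) ≥ ν ∀ i ⇒ f ∈ (u)^ν) →
NarrowRunsDie; ConeExit ⇐ CaseAExit (cleaned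
order > p ⇒ no isolated multiplicity-p successor, n ≥ 3; elementary, char-free) → ConeForcing (order
p, dL ≥ 2 ⇒ no isolated multiplicity-p
successor; the Chern/critical-direction containment) → ConeExit [dL ≥ 1 from a multiplicity-p
successor is routine and rides inside];
ClassicalRegimes ⇐ CharTwoSuspension (p = 2, n ≥ 3 ⇒ an isolated double run in n variables yields
one in n − 2) → LowDimRuns (n ≤ 2) →
ClassicalRegimes. Steer's engine from THIS route's side (a LINE, not an item): blow up the
cone-forced singular locus of ConeExit at unforced
stages and show (dL, m, cleaned order) improves lexicographically along the valuation.

KILL CRITERIA. (i) An explicit state c over F̄_p (p odd, n ≥ 3) with an isolated multiplicity-p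
successor and dL(c) ≠ 1 or cleaned order > p refutes
ConeExit (Theorems-level ¬ with kernel-checkable data): if the witness has dL = 2 = m − 1 with G_0
of a NEW exceptional type, repair ONCE by
adding that type to the binder (item ConeExitR); a second witness closes the route
`refuted:ConeExit`. (ii) An infinite (e.g. periodic or
self-similar) d = 1 isolated run refutes NarrowRunsDie AND the target AND FrobeniusClosing's
NoPeriodicIsolatedAtom at once — it is
Hauser–Perlega's forced cycle; close `refuted:NarrowRunsDie` and hand the witness to
certify-monsters / the negatives index. (iii)
¬PatchingRelPerfect or ¬DescentPerfectToAll proved ⇒ the whole perfect-field LU family (Valuative,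
CyclicCovers, IndSmooth, ShadowGame,
FrobeniusClosing, this) dies at that node; close with them. (iv) TorsorLUPerfect / LuAlphaPTorsor
(stmt-0641) proved elsewhere moots Steer
and ranks 6–7 (close `superseded --by` that route) — the engine items stay wanted as the answer to
HP's forced-cycle question;
IsolatedForcedTermination proved via FrobeniusClosing's certificate moots the engine only as a route
step, not as theorems.

NOT DECOMPOSED YET. The satellite-exclusion and arc lemmas (layer-2 children of NarrowRunsDie,
above); the Case-A / cone-forcing split of ConeExit; the p = 2
suspension lemma and the Lipman dictionary inside ClassicalRegimes; Steer's unforced-return lemma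
(deliberately rule-free, shared with
FrobeniusClosing; this route's proposed rule is recorded in the Two-layer plan, not filed); general
multiplicities ν with p | ν, ν > p and
embedding codimension ≥ 2 (card K2/K3: the tangential d = m = 2 sub-case and the tame case) —
outside the height-one target by design;
imperfect residue fields (wound points) — routed through DescentPerfectToAll exactly as ShadowGame /
FrobeniusClosing do.

CHEAPEST FALSIFIER. The one-step lemma ConeExit at its smallest informative size, p = 3, n = 4 (d ≥
2 needs a cone in ≤ n − 2 variables): take cleaned states
a = u1²u2 + a_4 + a_5 with an isolated singularity and a FORCED near point in direction e_4
(∇a_4(e_4) = 0, a_5(e_4) = 0) and decide whether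
that successor is isolated. RUN this session (exp/coneexit_check.py, pure python, exact linear
algebra over F_3, isolatedness by stabilisation
of ℓ(F_3[u]/(∂a + m^N)), N = 10, 11, 12): 8 isolated d = 2 starts → 8 forced multiplicity-3
successors → 0 isolated (ConeExit predicts 0);
9 isolated d = 1 starts → 9 near successors → 7 isolated (allowed); 9 order-4 starts → 1
multiplicity-3 successor, non-isolated (Case A);
0 violations in 2 483 successor computations. The same script at p = 2 would have caught the
contact-form exception (found by hand first:
u1u2 + u3²u4 + u4⁵ + u3⁷), which is why ConeExit carries p ≠ 2. Next rung for a refuter: p = 3, n =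
5 with cones in 2 and 3 variables
(d = 3, 2) and translations over F_9 (kit job; the script is parameterised `seed trials p n
families`).

NUMBERS. Chern number of Ω¹_(P^(s−1))(ν): c_(s−1) = ((ν−1)^s + (−1)^(s−1))/ν — for ν = p = 3, s = 2,
3, 4: 1, 3, 5; zero only for (ν, s) = (2, even).
Finite determinacy: μ < ∞ ⇒ right-(2μ − ord + 2)-determined (BoubakriGreuelMarkwig2010). Moh's
one-step bound: residual order rises by ≤ p^(e−1)
(= 1 at height one; Moh1987, Hauser2008Kangaroo); Hauser–Perlega unboundedness needs e ≥ 3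
(arXiv:1802.05010) — height one is exactly where the
forced-cycle question is sharp. This session's census: p = 3, n = 4, 26 isolated starts, 18
multiplicity-p successors, 7 isolated ones, all
from d = 1 states. Card's kit pools (2026-08-15): p = 3, n = 3, 80 starts — pool A (d = 1) 34/40
unique isolated near point, no depth-2
equimultiple point; pool B (d = 2, m = 3) 40/40 exit (j000285, j000668); all 2 186 ternary cubics
over F_3 have a critical point (j000718).
Items at open: 11 (1 target, 7 cruxes — 3 new + 4 shared —, 2 supports, 1 assembly).

DEFINITION REQUESTS. None at open: the dynamics is FrobeniusClosing's inlined `let` calculus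
verbatim (so the target and the four shared cruxes dedup by
signature), extended in the three engine items by four lets — OrdP (cleaned order exactly p), cone
(the degree-p part a_p as an
MvPolynomial), Linv (L = {w | a_p(X + w·S) = a_p(X) + a_p(w)·S^p} as a polynomial identity in a
fresh variable S, field-size independent and
a κ-subspace over every field), dL (finrank of its span). If provers ask, a Theorems-side
`AtomPointStep p n κ` factoring the calculus
(FrobeniusClosing's optional hygiene item) serves both routes; re-pointing by `set-signature` does
not change meaning.

Novelty: Searches (2026-08-16): all 20 open route files read (headers + items; none has a forced/unforced
split, a tangent-cone Chern argument or a
no-forced-cycle theorem; FrobeniusClosing read in full); `ledger idea list --problem … --status all`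
(184 cards; the 3 open new-mechanism
cards read in full: wild-cones-cannot-hide UNROUTED, wild-purity-at-valuations, henon-valuations;
closed cards' reasons for iterated-f-blowups,
schoen-reembedding, berkovich-skeleton-first, foliation-*, f-signature-acc, wild-zariski-riemann,
lipman-normalize, multiplicity-villamayor,
tame-belyi, canonical-model read); `ledger negatives` (0); `lit frontier ResolutionOfSingularities
--since 2023` (40 rows; 2602.06553,
2602.14266, 2303.18085, 2402.06207, 2510.26648 noted, none on forced cycles); `lit search --source
zbmath "infinitely near singular points
positive characteristic"` (12: Abhyankar 1983, Gignac–Ruggiero, Aroca–Hironaka–Vicente —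
curves/surfaces/char 0), `"Oda infinitely very near
singular points"` (1: Oda 1987), arXiv `"Hauser Perlega cycles …"` (1: 1802.05010), arXiv/zbMATH
'homogeneous polynomial degree divisible by
characteristic common zero of partial derivatives' / 'twisted one-forms projective space tangent
cone' (0); `lit galaxy search "infinitely
near singular points" --star all` (27: Brieskorn–Knörrer, Cossart–Giraud–Orbanz LNM 1101, Kollár,
Kawanoue–Matsuki IFP — classical near-point
theory, no forcing), `"near points after blowing up" --star all` (0); local searchd down for one
quer  [refs: 10.4134/jkms.2003.40.5.901, 10.1007/BFb0063393, 1802.05010, doi:10.4134/jkms.2003.40.5.901, doi:10.1007/BFb0063393, Varshavsky2014, CossartJannsenSaito2020]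

Barriers (technique_class: cone-gradient-chern-forcing, arc-lemma, barrier-inversion): - technique_class: cone-gradient-chern-forcing, arc-lemma, barrier-inversion
- Literature.Barriers.ResolutionOfSingularities.Hauser2003_kangarooShadeIncrease: evaded by object —
no shade / residual order / coefficient ideal is tracked; a kangaroo jump is allowed and irrelevant;
only ISOLATED recurrence is excluded, by cone geometry (Hauser's kangaroo surface is non-isolated
along its run).
- Literature.Barriers.ResolutionOfSingularities.hauserPerlega_mohProofBoundFails: consistent and
explanatory — Hauser–Perlega's runs are unforced (non-isolated, e = 3); the engine says height-one
isolated runs cannot even be infinite; their printed inability to force cycles is the prediction.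
- Literature.Barriers.ResolutionOfSingularities.Narasimhan1983_noSmoothHypersurfaceThroughTopLocus:
evaded — no smooth hypersurface containing the top locus is chosen; the invariance space L enters
only as the locus of near points and the new input is a Chern class on P(cone); Narasimhan's top
locus is a curve, i.e. unforced.
- Literature.Barriers.ResolutionOfSingularities.DirectrixSmallCharacteristicNarrow: respected by
scope — near points ⊂ P(L) is used only at CLOSED points over PERFECT κ (the dynamics visits
κ-rational points; L is Galois-stable hence defined over κ), where the Taylor argument is
unconditional; Hironaka's quadric needs an imperfect residue field; wound points go through
DescentPerfectToAll.
- Literature.Barriers.ResolutionOfSingularities.DimensionFourFrontier: it applies — Steer an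

History (route lifecycle, newest last):
- 2026-08-25T13:29:11Z · DORMANT — reconciler: no traction for 7.7 d (last activity item-evidence-added at 2026-08-17T19:15:50Z); parked, not closed — `ledger route dormant route-ResolutionOfSing (operator:999:1993853)
- 2026-08-26T14:55:57Z · REACTIVATED — director-resolution L0 tranche seated (D-0089 rescue); operator clears dormancy (operator:999:3568581)
- 2026-08-26T15:40:59Z · DORMANT — reconciler: no traction for 8.8 d (last activity item-evidence-added at 2026-08-17T19:15:50Z); parked, not closed — `ledger route dormant route-ResolutionOfSing (operator:999:2548454)
- 2026-08-26T16:24:56Z · REACTIVATED — dormant cleared (operator:999:1031787)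

sub-problem: ResolutionOfSingularities · status: open · opened planner-plan-novel-ResolutionOfSingularities-Re-dc19aa3a-c-v2-g8-0 2026-08-16T21:27:54Z · rev 4 · ledger route-ResolutionOfSingularities-WildCones
GENERATED by the gate from the ledger (D-0016/17). Provers cite these decls: `theorem foo : Summit.ResolutionOfSingularities.ResolutionOfSingularities.Theses.WildCones.<Decl> := …` in Summits/ResolutionOfSingularities/ResolutionOfSingularities/Theorems/<Name>.lean.
-/

namespace Summit.ResolutionOfSingularities.ResolutionOfSingularities.Theses.WildCones

open scoped BigOperators Topology Manifold Classical MeasureTheory ProbabilityTheory Matrix InnerProductSpace ComplexConjugate ContinuousMap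
open Filter Set Function TopologicalSpace MeasureTheory

attribute [summit_statement] _root_.ResolutionOfSingularities

/-- item stmt-ResolutionOfSingularities-16343 · target · rank 0 · closed · proved by Summit.ResolutionOfSingularities.ResolutionOfSingularities.Theorems.WildCones.IsolatedForcedTermination_proof (prover) · by planner
why it might fail: an honest infinite chain of isolated p-fold infinitely near points of a height-one atom — Hauser–Perlega's missing forced cycle — refutes it; unknown for p ≥ 3, n ≥ 4.
sources: arXiv:1802.05010, HauserPerlega2019, arXiv:1412.0868, BoubakriGreuelMarkwig2010
[target] the TARGET (IsoDrop for height-one atoms, all n, all perfect fields): no start series,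
chart sequence and translation sequence over a perfect field of char p yields an INFINITE run of the
point-blow-up dynamics all of whose states are isolated of multiplicity p. Derived in `closes` as
ClosingReduction NoPeriodicIsolatedAtom BoundedMilnor; provable directly by anyone with a budget (a
ranking on μ-bounded states) — char 2 looks like a budget regime (spine card toy B: μ drops by a
constant at every forced step, ~290 steps, n = 3,4,5); consumed by Steer. -/
@[route_item "route-ResolutionOfSingularities-WildCones", crux]
def IsolatedForcedTermination : Prop :=
  ∀ p : ℕ, p.Prime → ∀ n : ℕ, 0 < n → ∀ (κ : Type) [Field κ] [CharP κ p] [PerfectField κ] (c₀ : (Fin n → ℕ) → κ) (i : ℕ → Fin n) (t : ℕ → Fin n → κ), let clean : ((Fin n → ℕ) → κ) → ((Fin n → ℕ) → κ) := fun c A => @ite κ (∀ j, p ∣ A j) (Classical.dec _) 0 (c A); let bl : Fin n → ((Fin n → ℕ) → κ) → ((Fin n → ℕ) → κ) := fun i c B => @ite κ (Finset.sum (Finset.univ.erase i) (fun j => B j) ≤ B i) (Classical.dec _) (c (Function.update B i (B i - Finset.sum (Finset.univ.erase i) (fun j => B j)))) 0; let ord : ((Fin n → ℕ) → κ) → ℕ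 := fun c => sInf {m : ℕ | ∃ A, c A ≠ 0 ∧ m = Finset.sum Finset.univ (fun j => A j)}; let dv : Fin n → ℕ → ((Fin n → ℕ) → κ) → ((Fin n → ℕ) → κ) := fun i s c B => c (Function.update B i (B i + s)); let tr : Fin n → (Fin n → κ) → ℕ → ((Fin n → ℕ) → κ) → ((Fin n → ℕ) → κ) := fun i τ s c B => Finset.sum (Fintype.piFinset (fun _ : Fin n => Finset.range (B i + s + 1))) (fun D => @ite κ (D i = 0) (Classical.dec _) (c (B + D) * Finset.prod (Finset.univ.erase i) (fun j => ((Nat.choose (B j + D j) (B j) : ℕ) : κ) * τ j ^ (D j))) 0); let step : Fin n → (Fin n → κ) → ((Fin n → ℕ) → κ) → ((Fin n → ℕ) → κ) := fun i τ c => clean (tr i τ (@ite ℕ (p ≤ ord (clean c)) (Classical.dec _) p 0) (dv i (@ite ℕ (p ≤ ord (clean c)) (Classical.dec _) p 0) (bl i (clean c)))); let run : ((Fin n → ℕ) → κ) → (ℕ → Fin n) → (ℕ → Fin n → κ) → ℕ → ((Fin n → ℕ) → κ) := fun c₀ i t m => @Nat.rec (fun _ => (Fin n → ℕ) → κ) c₀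 (fun m c => step (i m) (t m) c) m; let ser : ((Fin n → ℕ) → κ) → MvPowerSeries (Fin n) κ := fun c => show MvPowerSeries (Fin n) κ from fun A : Fin n →₀ ℕ => clean c ⇑A; let pd : Fin n → MvPowerSeries (Fin n) κ → MvPowerSeries (Fin n) κ := fun i f => show MvPowerSeries (Fin n) κ from fun A : Fin n →₀ ℕ => ((A i + 1 : ℕ) : κ) * f (A + Finsupp.single i 1); let jac : ((Fin n → ℕ) → κ) → Ideal (MvPowerSeries (Fin n) κ) := fun c => Ideal.span (Set.range (fun i => pd i (ser c))); let Isol : ((Fin n → ℕ) → κ) → Prop := fun c => Module.Finite κ (MvPowerSeries (Fin n) κ ⧸ jac c); let MultP : ((Fin n → ℕ) → κ) → Prop := fun c => (∃ A, clean c A ≠ 0) ∧ ∀ A, clean c A ≠ 0 → p ≤ Finset.sum Finset.univ (fun j => A j); ¬ (∀ m, Isol (run c₀ i t m) ∧ MultP (run c₀ i t m))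

-- `IsolatedForcedTermination` holds: proved by `Summit.ResolutionOfSingularities.ResolutionOfSingularities.Theorems.WildCones.IsolatedForcedTermination_proof` (its module imports this route file, so no `_holds` link can be stated here).

/-- item stmt-ResolutionOfSingularities-16882 · crux · rank 2 · closed · proved by Summit.ResolutionOfSingularities.ResolutionOfSingularities.Theorems.NarrowRunsDie_proof @ 935f8574a8b7 (prover) · by planner
why it might fail: the satellite-exclusion step (next near direction never tangent to an old exceptional component when d = 1) is only sketched in dimension ≥ 3; a tangential d = 1 recurrence with growing higher Taylor data would be a genuine forced kangaroo and refute the crux (and the target).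
sources: arXiv:1802.05010, doi:10.4134/jkms.2003.40.5.901, CossartJannsenSaito2020, Kollar2007
[crux] NARROW RUNS DIE (card K1, d = 1 branch): for p odd and n ≥ 3, there is no infinite run of the
dynamics all of whose states are isolated of multiplicity p, of cleaned order EXACTLY p, with
one-dimensional cone-invariance space L(a_p) = {w : a_p(X + wS) = a_p(X) + a_p(w) S^p} (dL = 1).
Mechanism: d = 1 makes the near point unique and FORCED at every stage; a satellite near point would
need a direction in L/⟨v⟩ = 0, so recurrence is free; an infinite free run of p-fold points consists
of the infinitely near points of one smooth formal arc γ, and then z^p + a ∈ I_γ^p (arc lemma), so γ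
⊂ Sing — the start was not isolated. [difficulty: L] -/
@[route_item "route-ResolutionOfSingularities-WildCones", crux]
def NarrowRunsDie : Prop :=
  ∀ p : ℕ, p.Prime → p ≠ 2 → ∀ n : ℕ, 3 ≤ n → ∀ (κ : Type) [Field κ] [CharP κ p] [PerfectField κ] (c₀ : (Fin n → ℕ) → κ) (i : ℕ → Fin n) (t : ℕ → Fin n → κ), let clean : ((Fin n → ℕ) → κ) → ((Fin n → ℕ) → κ) := fun c A => @ite κ (∀ j, p ∣ A j) (Classical.dec _) 0 (c A); let bl : Fin n → ((Fin n → ℕ) → κ) → ((Fin n → ℕ) → κ) := fun i c B => @ite κ (Finset.sum (Finset.univ.erase i) (fun j => B j) ≤ B i) (Classical.dec _) (c (Function.update B i (B i - Finset.sum (Finset.univ.erase i) (fun j => B j)))) 0; let ord : ((Fin n → ℕ) → κ) → ℕ := fun c => sInf {m : ℕ | ∃ A, c A ≠ 0 ∧ m = Finset.sum Finset.univ (fun j => A j)}; let dv : Fin n → ℕ → ((Fin n → ℕ) → κ) → ((Fin n → ℕ) → κ) := fun i s c B => c (Function.update B i (B i + s)); let tr : Fin n → (Fin n → κ) → ℕ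 → ((Fin n → ℕ) → κ) → ((Fin n → ℕ) → κ) := fun i τ s c B => Finset.sum (Fintype.piFinset (fun _ : Fin n => Finset.range (B i + s + 1))) (fun D => @ite κ (D i = 0) (Classical.dec _) (c (B + D) * Finset.prod (Finset.univ.erase i) (fun j => ((Nat.choose (B j + D j) (B j) : ℕ) : κ) * τ j ^ (D j))) 0); let step : Fin n → (Fin n → κ) → ((Fin n → ℕ) → κ) → ((Fin n → ℕ) → κ) := fun i τ c => clean (tr i τ (@ite ℕ (p ≤ ord (clean c)) (Classical.dec _) p 0) (dv i (@ite ℕ (p ≤ ord (clean c)) (Classical.dec _) p 0) (bl i (clean c)))); let run : ((Fin n → ℕ) → κ) → (ℕ → Fin n) → (ℕ → Fin n → κ) → ℕ → ((Fin n → ℕ) → κ) := fun c₀ i t m => @Nat.rec (fun _ => (Fin n → ℕ) → κ) c₀ (fun m c => step (i m) (t m) c) m; let ser : ((Fin n → ℕ) → κ) → MvPowerSeries (Fin n) κ := fun c => show MvPowerSeries (Fin n) κ from fun A : Fin n →₀ ℕ => clean c ⇑A; let pd : Fin n → MvPowerSeries (Fin n) κ → MvPowerSeries (Fin n) κ :=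 fun i f => show MvPowerSeries (Fin n) κ from fun A : Fin n →₀ ℕ => ((A i + 1 : ℕ) : κ) * f (A + Finsupp.single i 1); let jac : ((Fin n → ℕ) → κ) → Ideal (MvPowerSeries (Fin n) κ) := fun c => Ideal.span (Set.range (fun i => pd i (ser c))); let Isol : ((Fin n → ℕ) → κ) → Prop := fun c => Module.Finite κ (MvPowerSeries (Fin n) κ ⧸ jac c); let MultP : ((Fin n → ℕ) → κ) → Prop := fun c => (∃ A, clean c A ≠ 0) ∧ ∀ A, clean c A ≠ 0 → p ≤ Finset.sum Finset.univ (fun j => A j); let OrdP : ((Fin n → ℕ) → κ) → Prop := fun c => ∃ A, clean c A ≠ 0 ∧ Finset.sum Finset.univ (fun j => A j) = p; let cone : ((Fin n → ℕ) → κ) → MvPolynomial (Fin n) κ := fun c => Finset.sum (Fintype.piFinset (fun _ : Fin n => Finset.range (p + 1))) (fun A => @ite (MvPolynomial (Fin n) κ) (Finset.sum Finset.univ (fun j => A j) = p) (Classical.dec _) (MvPolynomial.monomial (Finsupp.equivFunOnFinite.symm A) (clean c A)) 0); let Linv : ((Fin n → ℕ) → κ) → Set (Fin n → κ) := fun c =>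 {w : Fin n → κ | MvPolynomial.aeval (fun j : Fin n => (MvPolynomial.X (some j) : MvPolynomial (Option (Fin n)) κ) + MvPolynomial.C (w j) * MvPolynomial.X none) (cone c) = MvPolynomial.rename some (cone c) + MvPolynomial.C (MvPolynomial.eval w (cone c)) * (MvPolynomial.X none) ^ p}; let dL : ((Fin n → ℕ) → κ) → ℕ := fun c => Module.finrank κ (Submodule.span κ (Linv c)); (∀ m, Isol (run c₀ i t m) ∧ MultP (run c₀ i t m)) → (∀ m, OrdP (run c₀ i t m) ∧ dL (run c₀ i t m) = 1) → False

-- `NarrowRunsDie` holds: proved by `Summit.ResolutionOfSingularities.ResolutionOfSingularities.Theorems.NarrowRunsDie_proof` @ 935f8574a8b7 (its module imports this route file, so no `_holds` link can be stated here).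

/-- item stmt-ResolutionOfSingularities-16883 · crux · rank 3 · closed · proved by Summit.ResolutionOfSingularities.ResolutionOfSingularities.Theorems.WildConesConeExit.ConeExit_proof @ 902699d7ed71 (prover) · by planner
why it might fail: at p = 2 it IS false (a = u1u2 + u3²u4 + u4⁵ + u3⁷, n = 4: isolated double successor at e3 with d = 2 — contact-form exception), hence p ≠ 2; for odd p the containment Sing(X') ⊇ P(N) ∩ {Θ_N = a_(p+1) = 0} through EVERY near point is checked on families only (p = 3, n = 4: 8/8).
sources: doi:10.1007/BFb0063393, Hironaka1970AdditiveGroups, CossartJannsenSaito2020, Kollar2007, arXiv:1802.05010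
[crux] ONE-STEP CONE EXIT LEMMA (card P3 + Chern forcing, typed one blow-up at a time, finitely
refutable): p odd, n ≥ 3, κ perfect of char p; if a state c (coefficients of a(u)) is isolated of
multiplicity p and some successor step i τ c (chart i, translation τ) is again isolated of
multiplicity p, then c has cleaned order EXACTLY p and dL c = 1. Content: cleaned order > p ⇒ every
successor is non-isolated or of order < p (Sing(X') ∩ E ⊇ {z' = 0, a_{m}(v) = 0}, dimension ≥ n − 2
≥ 1); order p and d = dim L ≥ 2 ⇒ gradient-invariance space M has m ≥ d + 1 ≥ 3, the Chern lemma
gives a critical direction q of the cone modulo M, G|_N is a p-th power on N = M ⊕ ⟨q⟩, and Sing(X')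
∩ E ⊇ P(N) ∩ {Θ_N = 0} ∩ {a_{p+1} = 0} has components of dimension ≥ m − 2 ≥ 1 through every near
point; d = 0 ⇒ no near point. [difficulty: M] -/
@[route_item "route-ResolutionOfSingularities-WildCones", crux]
def ConeExit : Prop :=
  ∀ p : ℕ, p.Prime → p ≠ 2 → ∀ n : ℕ, 3 ≤ n → ∀ (κ : Type) [Field κ] [CharP κ p] [PerfectField κ] (c : (Fin n → ℕ) → κ) (i : Fin n) (τ : Fin n → κ), let clean : ((Fin n → ℕ) → κ) → ((Fin n → ℕ) → κ) := fun c A => @ite κ (∀ j, p ∣ A j) (Classical.dec _) 0 (c A); let bl : Fin n → ((Fin n → ℕ) → κ) → ((Fin n → ℕ) → κ) := fun i c B => @ite κ (Finset.sum (Finset.univ.erase i) (fun j => B j) ≤ B i) (Classical.dec _) (c (Function.update B i (B i - Finset.sum (Finset.univ.erase i) (fun j => B j)))) 0; let ord : ((Fin n → ℕ) → κ) → ℕ := fun c => sInf {m : ℕ | ∃ A, c A ≠ 0 ∧ m = Finset.sum Finset.univ (fun j => A j)}; let dv : Fin n → ℕ → ((Fin n → ℕ) → κ) → ((Fin n → ℕ)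 → κ) := fun i s c B => c (Function.update B i (B i + s)); let tr : Fin n → (Fin n → κ) → ℕ → ((Fin n → ℕ) → κ) → ((Fin n → ℕ) → κ) := fun i τ s c B => Finset.sum (Fintype.piFinset (fun _ : Fin n => Finset.range (B i + s + 1))) (fun D => @ite κ (D i = 0) (Classical.dec _) (c (B + D) * Finset.prod (Finset.univ.erase i) (fun j => ((Nat.choose (B j + D j) (B j) : ℕ) : κ) * τ j ^ (D j))) 0); let step : Fin n → (Fin n → κ) → ((Fin n → ℕ) → κ) → ((Fin n → ℕ) → κ) := fun i τ c => clean (tr i τ (@ite ℕ (p ≤ ord (clean c)) (Classical.dec _) p 0) (dv i (@ite ℕ (p ≤ ord (clean c)) (Classical.dec _) p 0) (bl i (clean c)))); let ser : ((Fin n → ℕ) → κ) → MvPowerSeries (Fin n) κ := fun c => show MvPowerSeries (Fin n) κ from fun A : Fin n →₀ ℕ => clean c ⇑A; let pd : Fin n → MvPowerSeries (Fin n) κ → MvPowerSeries (Fin n) κ := fun i f => show MvPowerSeries (Fin n) κ from fun A : Fin n →₀ ℕ => ((A i + 1 : ℕ) : κ) * f (A + Finsupp.single i 1); let jac : ((Fin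 n → ℕ) → κ) → Ideal (MvPowerSeries (Fin n) κ) := fun c => Ideal.span (Set.range (fun i => pd i (ser c))); let Isol : ((Fin n → ℕ) → κ) → Prop := fun c => Module.Finite κ (MvPowerSeries (Fin n) κ ⧸ jac c); let MultP : ((Fin n → ℕ) → κ) → Prop := fun c => (∃ A, clean c A ≠ 0) ∧ ∀ A, clean c A ≠ 0 → p ≤ Finset.sum Finset.univ (fun j => A j); let OrdP : ((Fin n → ℕ) → κ) → Prop := fun c => ∃ A, clean c A ≠ 0 ∧ Finset.sum Finset.univ (fun j => A j) = p; let cone : ((Fin n → ℕ) → κ) → MvPolynomial (Fin n) κ := fun c => Finset.sum (Fintype.piFinset (fun _ : Fin n => Finset.range (p + 1))) (fun A => @ite (MvPolynomial (Fin n) κ) (Finset.sum Finset.univ (fun j => A j) = p) (Classical.dec _) (MvPolynomial.monomial (Finsupp.equivFunOnFinite.symm A) (clean c A)) 0); let Linv : ((Fin n → ℕ) → κ) → Set (Fin n → κ) := fun c => {w : Fin n → κ | MvPolynomial.aeval (fun j : Fin n => (MvPolynomial.X (some j) : MvPolynomial (Option (Fin n)) κ) + MvPolynomial.C (w j) * MvPolynomial.X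 none) (cone c) = MvPolynomial.rename some (cone c) + MvPolynomial.C (MvPolynomial.eval w (cone c)) * (MvPolynomial.X none) ^ p}; let dL : ((Fin n → ℕ) → κ) → ℕ := fun c => Module.finrank κ (Submodule.span κ (Linv c)); Isol c → MultP c → Isol (step i τ c) → MultP (step i τ c) → OrdP c ∧ dL c = 1

-- `ConeExit` holds: proved by `Summit.ResolutionOfSingularities.ResolutionOfSingularities.Theorems.WildConesConeExit.ConeExit_proof` @ 902699d7ed71 (its module imports this route file, so no `_holds` link can be stated here).

/-- item stmt-ResolutionOfSingularities-16345 · crux · rank 4 · open · by planner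
why it might fail: the unforced regime may carry the whole difficulty (CossartPiltant2019 Rem. 3.2: ω rises under a permissible centre at n = 4; HP's cycles are unforced): then forced termination buys nothing and Steer is LuAlphaPTorsor (stmt-0641) again.
sources: arXiv:1412.0868, arXiv:1802.05010, CutkoskyMourtada2019, NovacoskiSpivakovsky2014, Temkin2013, Literature.Barriers.ResolutionOfSingularities.DimensionFourFrontier
[crux] STEERING: if no perfect field carries an infinite chain of isolated multiplicity-p infinitely
near points of a height-one atom (IsolatedForcedTermination, the target), then α_p-torsors over
bases regular at the centre are uniformizable along every valuation over every perfect field (the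
body of TorsorLUPerfect, inlined). Content: at NON-isolated (unforced) stages a positive-dimensional
permissible centre through the centre of the valuation exists; choose it (maximal E-permissible
coordinate stratum, CossartPiltant2019-style) and show the run returns to the isolated regime or
drops multiplicity — the dictionary model/valuation ↔ coefficient dynamics is ShadowGame's
WinToTorsorLU (0-dimensional reduction NovacoskiSpivakovsky2014, Cohen coefficient fields over
perfect κ, toroidal endgame Kato1994/Niziol2006). [deps: ClosingReduction] [difficulty:
open-problem] -/
@[route_item "route-ResolutionOfSingularities-WildCones", crux]
def Steer : Prop :=
  IsolatedForcedTermination → ∀ p : ℕ, p.Prime → ∀ (k K : Type) [Field k] [CharP k p] [PerfectField k] [Field K] [Algebra k K] (O : ValuationSubring K) (A₀ : Subalgebra k K) (h₀ : A₀.toSubring ≤ O.toSubring) (t : K), A₀.FG → t ^ p ∈ A₀ → IsFractionRing (Algebra.adjoin k (insert t (A₀ : Set K))) K → IsRegularLocalRing (Localization.AtPrime (Ideal.comap (Subring.inclusion h₀) (IsLocalRing.maximalIdeal O))) → ∃ (A : Subalgebra k K) (h : A.toSubring ≤ O.toSubring), A₀ ≤ A ∧ t ∈ A ∧ A.FG ∧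 IsFractionRing A K ∧ IsRegularLocalRing (Localization.AtPrime (Ideal.comap (Subring.inclusion h) (IsLocalRing.maximalIdeal O)))

/-- item stmt-ResolutionOfSingularities-16884 · crux · rank 5 · closed · proved by Summit.ResolutionOfSingularities.ResolutionOfSingularities.Theorems.WildCones.ClassicalRegimes_proof (prover) · by planner
why it might fail: p = 2 needs hyperbolic splitting to commute with the blow-up/cleaning dynamics at every stage and keep isolatedness (translation may un-split the quadratic part); n = 2 needs the dictionary state ↦ local ring of the strict transform to be exact (u_i^p divided only at cleaned order ≥ p).
sources: Lipman1978, doi:10.1007/bf02570742, doi:10.1016/j.jalgebra.2025.10.023, Kollar2007, CossartJannsenSaito2020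
[crux] CLASSICAL REGIMES: the target restricted to (n ≤ 2) ∨ (p = 2). n = 1: point blow-ups of the
plane curve z^p + a(u) exit multiplicity p (multiplicity sequences). n = 2: every state of an
isolated chain is the local ring of Lipman's NORMALISED blow-up (an isolated hypersurface point is
normal), so an infinite chain contradicts Lipman1978. p = 2, n ≥ 3: a cleaned state of order 2 has
non-zero alternating polar form, a hyperbolic pair splits off over κ[[u]] (Morse modulo squares,
card morse-mod-squares; Greuel–Kröning doi:10.1007/bf02570742, Greuel–Pfister
doi:10.1016/j.jalgebra.2025.10.023), the dynamics of z² + u1u2 + g(u'') is the suspended dynamics of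
z² + g(u''), and induction on n ends in n ≤ 2; cleaned order > 2 exits by the Case-A argument of
ConeExit (char-free). [difficulty: M] -/
@[route_item "route-ResolutionOfSingularities-WildCones", crux]
def ClassicalRegimes : Prop :=
  ∀ p : ℕ, p.Prime → ∀ n : ℕ, 0 < n → (n ≤ 2 ∨ p = 2) → ∀ (κ : Type) [Field κ] [CharP κ p] [PerfectField κ] (c₀ : (Fin n → ℕ) → κ) (i : ℕ → Fin n) (t : ℕ → Fin n → κ), let clean : ((Fin n → ℕ) → κ) → ((Fin n → ℕ) → κ) := fun c A => @ite κ (∀ j, p ∣ A j) (Classical.dec _) 0 (c A); let bl : Fin n → ((Fin n → ℕ) → κ) → ((Fin n → ℕ) → κ) := fun i c B => @ite κ (Finset.sum (Finset.univ.erase i) (fun j => B j) ≤ B i) (Classical.dec _) (c (Function.update B i (B i - Finset.sum (Finset.univ.erase i) (fun j => B j)))) 0; let ord : ((Fin n → ℕ) → κ) → ℕ := fun c => sInf {m : ℕ | ∃ A, c A ≠ 0 ∧ m = Finset.sum Finset.univ (fun j => A j)}; let dv : Fin n → ℕ → ((Fin n → ℕ) → κ) → ((Fin n → ℕ) → κ)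 := fun i s c B => c (Function.update B i (B i + s)); let tr : Fin n → (Fin n → κ) → ℕ → ((Fin n → ℕ) → κ) → ((Fin n → ℕ) → κ) := fun i τ s c B => Finset.sum (Fintype.piFinset (fun _ : Fin n => Finset.range (B i + s + 1))) (fun D => @ite κ (D i = 0) (Classical.dec _) (c (B + D) * Finset.prod (Finset.univ.erase i) (fun j => ((Nat.choose (B j + D j) (B j) : ℕ) : κ) * τ j ^ (D j))) 0); let step : Fin n → (Fin n → κ) → ((Fin n → ℕ) → κ) → ((Fin n → ℕ) → κ) := fun i τ c => clean (tr i τ (@ite ℕ (p ≤ ord (clean c)) (Classical.dec _) p 0) (dv i (@ite ℕ (p ≤ ord (clean c)) (Classical.dec _) p 0) (bl i (clean c)))); let run : ((Fin n → ℕ) → κ) → (ℕ → Fin n) → (ℕ → Fin n → κ) → ℕ → ((Fin n → ℕ) → κ) := fun c₀ i t m => @Nat.rec (fun _ => (Fin n → ℕ) → κ) c₀ (fun m c => step (i m) (t m) c) m; let ser : ((Fin n → ℕ) → κ) → MvPowerSeries (Fin n) κ := fun c => show MvPowerSeries (Fin n) κ from fun A : Fin n →₀ ℕ => clean c ⇑A;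 let pd : Fin n → MvPowerSeries (Fin n) κ → MvPowerSeries (Fin n) κ := fun i f => show MvPowerSeries (Fin n) κ from fun A : Fin n →₀ ℕ => ((A i + 1 : ℕ) : κ) * f (A + Finsupp.single i 1); let jac : ((Fin n → ℕ) → κ) → Ideal (MvPowerSeries (Fin n) κ) := fun c => Ideal.span (Set.range (fun i => pd i (ser c))); let Isol : ((Fin n → ℕ) → κ) → Prop := fun c => Module.Finite κ (MvPowerSeries (Fin n) κ ⧸ jac c); let MultP : ((Fin n → ℕ) → κ) → Prop := fun c => (∃ A, clean c A ≠ 0) ∧ ∀ A, clean c A ≠ 0 → p ≤ Finset.sum Finset.univ (fun j => A j); ¬ (∀ m, Isol (run c₀ i t m) ∧ MultP (run c₀ i t m))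

-- `ClassicalRegimes` holds: proved by `Summit.ResolutionOfSingularities.ResolutionOfSingularities.Theorems.WildCones.ClassicalRegimes_proof` (its module imports this route file, so no `_holds` link can be stated here).

/-- item stmt-ResolutionOfSingularities-16161 · crux · rank 6 · open · by planner
why it might fail: patching local uniformizations into one proper regular model is known only in dim ≤ 3 (Zariski; CossartPiltant2008 Prop 4.9 / Piltant2013 need embedded resolution one dimension down); in dim ≥ 4 no reduction Res ⇐ LU exists even in char 0 (CutkoskyMourtada2019 p. 3).
sources: CutkoskyMourtada2019, Temkin2013, CossartPiltant2019, NovacoskiSpivakovsky2014, Literature.Barriers.ResolutionOfSingularities.DimensionFourFrontier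
[crux] Zariski patching over PERFECT ground fields: for every prime p, relative local uniformization
(every f.g. R ⊆ O is dominated by a f.g. A ⊆ O with Frac A = K, regular at the centre) for all f.g.
K/k with k perfect of char p implies that every reduced separated scheme of finite type over every
perfect field of char p has a resolution. Fibrewise identical to Valuative's PatchingRel (stmt-0642)
restricted to perfect k — one patching argument proves both. [difficulty: open-problem] -/
@[route_item "route-ResolutionOfSingularities-WildCones", crux]
def PatchingRelPerfect : Prop :=
  ∀ p : ℕ, p.Prime → (∀ (k K : Type) [Field k] [CharP k p] [PerfectField k] [Field K] [Algebra k K], (⊤ : IntermediateField k K).FG → ∀ O : ValuationSubring K, (∀ c : k, algebraMap k K c ∈ O) → ∀ R : Subalgebra k K, R.FG → R.toSubring ≤ O.toSubring → ∃ (A : Subalgebra k K) (h : A.toSubring ≤ O.toSubring), R ≤ A ∧ A.FG ∧ IsFractionRing A K ∧ IsRegularLocalRing (Localization.AtPrime (Ideal.comap (Subring.inclusion h) (IsLocalRing.maximalIdeal O)))) → ∀ (k : Type) [Field k] [CharP k p] [PerfectField k] (X : AlgebraicGeometry.Scheme.{0}) (f : X ⟶ AlgebraicGeometry.Spec (.of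 k)), AlgebraicGeometry.IsSeparated f → AlgebraicGeometry.LocallyOfFiniteType f → AlgebraicGeometry.QuasiCompact f → AlgebraicGeometry.IsReduced X → Literature.AlgebraicGeometry.Resolution.Scheme.HasResolution X

/-- item stmt-ResolutionOfSingularities-16162 · crux · rank 7 · open · by planner
why it might fail: rests on Temkin2013 Thm 1.3.2 (vendored fact with an unproved leaf in tree, Temkin2013RelativeCurveSmoothFibre) and on Temkin's model dominating the GIVEN R (relative form); smooth ≠ regular bookkeeping at each tower step.
sources: Temkin2013, arXiv:0804.1554, Literature.AlgebraicGeometry.Resolution.Temkin2013Relative, Literature.Barriers.ResolutionOfSingularities.InseparableBaseChange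
[crux] Temkin's inseparable reduction over PERFECT ground fields: for every prime p, LU of
α_p-torsors over bases regular at the centre (TorsorLUPerfect at p) implies relative LU for every
f.g. K/k, k perfect of char p (Temkin2013 Thm 1.3.2: after a finite purely inseparable L/K an affine
model is uniformized with smooth centre; Frobenius F^n moves it into K (k perfect, so k^{p^n} = k
and the transport is finite); the tower K₀ ⊂ … ⊂ K of degree-p radical steps is climbed by the
torsor crux). Valuative's TorsorToLurel (stmt-10968) is the all-k version. [difficulty: L] -/
@[route_item "route-ResolutionOfSingularities-WildCones", crux]
def TorsorToLurelPerfect : Prop :=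
  ∀ p : ℕ, p.Prime → (∀ (k K : Type) [Field k] [CharP k p] [PerfectField k] [Field K] [Algebra k K] (O : ValuationSubring K) (A₀ : Subalgebra k K) (h₀ : A₀.toSubring ≤ O.toSubring) (t : K), A₀.FG → t ^ p ∈ A₀ → IsFractionRing (Algebra.adjoin k (insert t (A₀ : Set K))) K → IsRegularLocalRing (Localization.AtPrime (Ideal.comap (Subring.inclusion h₀) (IsLocalRing.maximalIdeal O))) → ∃ (A : Subalgebra k K) (h : A.toSubring ≤ O.toSubring), A₀ ≤ A ∧ t ∈ A ∧ A.FG ∧ IsFractionRing A K ∧ IsRegularLocalRing (Localization.AtPrime (Ideal.comap (Subring.inclusion h) (IsLocalRing.maximalIdeal O)))) → ∀ (k K : Type) [Field k] [CharP k p] [PerfectField k] [Field K] [Algebra k K], (⊤ : IntermediateField k K).FG → ∀ O : ValuationSubring K, (∀ c : k, algebraMap k K c ∈ O) → ∀ R : Subalgebra k K, R.FG → R.toSubring ≤ O.toSubring → ∃ (A : Subalgebra k K) (h : A.toSubring ≤ O.toSubring), R ≤ A ∧ A.FG ∧ IsFractionRing A K ∧ IsRegularLocalRing (Localization.AtPrime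 (Ideal.comap (Subring.inclusion h) (IsLocalRing.maximalIdeal O)))

/-- item stmt-ResolutionOfSingularities-0549 · crux · rank 8 · open · by planner
why it might fail: only known mechanism spreads X over a f.g. field of definition and base-changes a resolution over a perfect subfield back; regular is not geometrically regular under inseparable extension (EGA IV 6.7.4), e.g. k = F_p((t)) (Temkin2008 Question 3.3.3 open).
sources: arXiv:math/0703678, Kollar2007, Literature.Barriers.ResolutionOfSingularities.InseparableBaseChange, Literature.Barriers.ResolutionOfSingularities.RegularNotGeometricallyRegular
PerfectToAll: for a prime p, resolution of all reduced separated finite-type schemes over all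
PERFECT fields of char p implies ResolutionInChar p (all fields of char p). Expected inputs:
Neron-Popescu (Stacks 07GC), spreading out, openness of regular locus on excellent schemes;
regularity is not stable under inseparable ground field extension, which is the difficulty. -/
@[route_item "route-ResolutionOfSingularities-WildCones", crux]
def DescentPerfectToAll : Prop :=
  ∀ p : ℕ, p.Prime → (∀ (k : Type) [Field k] [CharP k p] [PerfectField k] (X : AlgebraicGeometry.Scheme.{0}) (f : X ⟶ AlgebraicGeometry.Spec (.of k)), AlgebraicGeometry.IsSeparated f → AlgebraicGeometry.LocallyOfFiniteType f → AlgebraicGeometry.QuasiCompact f → AlgebraicGeometry.IsReduced X → Literature.AlgebraicGeometry.Resolution.Scheme.HasResolution X) → Literature.AlgebraicGeometry.Resolution.ResolutionInChar.{0} p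

/-- item stmt-ResolutionOfSingularities-16158 · support · rank 9 · open · by planner
sources: Temkin2013, CutkoskyMourtada2019, CossartPiltant2019, Literature.Barriers.ResolutionOfSingularities.DimensionFourFrontier
[target] local uniformization of α_p-torsors over bases regular at the centre, over PERFECT ground
fields: k perfect of char p, K/k, O a valuation ring of K, A₀ ⊆ O f.g. regular at the centre, t ∈ K
with t^p ∈ A₀ and Frac(A₀[t]) = K ⇒ some f.g. A with A₀[t] ⊆ A ⊆ O, Frac A = K, A regular at the
centre (Valuative's LuAlphaPTorsor, stmt-0641, with [PerfectField k] added). Derived in `closes` as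
WinToTorsorLU applied to ShadowGameWin. -/
@[route_item "route-ResolutionOfSingularities-WildCones"]
def TorsorLUPerfect : Prop :=
  ∀ p : ℕ, p.Prime → ∀ (k K : Type) [Field k] [CharP k p] [PerfectField k] [Field K] [Algebra k K] (O : ValuationSubring K) (A₀ : Subalgebra k K) (h₀ : A₀.toSubring ≤ O.toSubring) (t : K), A₀.FG → t ^ p ∈ A₀ → IsFractionRing (Algebra.adjoin k (insert t (A₀ : Set K))) K → IsRegularLocalRing (Localization.AtPrime (Ideal.comap (Subring.inclusion h₀) (IsLocalRing.maximalIdeal O))) → ∃ (A : Subalgebra k K) (h : A.toSubring ≤ O.toSubring), A₀ ≤ A ∧ t ∈ A ∧ A.FG ∧ IsFractionRing A K ∧ IsRegularLocalRing (Localization.AtPrime (Ideal.comap (Subring.inclusion h) (IsLocalRing.maximalIdeal O)))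

/-- item stmt-ResolutionOfSingularities-16885 · support · rank 9 · closed · proved by Summit.ResolutionOfSingularities.ResolutionOfSingularities.Theorems.WildConesConeExit.chernCriticalDirection_proof @ ba4428222d8d (prover) · by planner
sources: doi:10.1007/BFb0063393, Kollar2007
[support] CHERN LEMMA (card P1, provable now; the existence lemma ConeExit consumes): for p odd, s ≥
2 and k algebraically closed of characteristic p, every non-zero form H of degree p in s variables
has a point v ≠ 0 of k^s at which all partial derivatives ∂_j H vanish ((∂_j H) is a section of
Ω¹_(P^(s−1))(p) by Euler degeneracy; c_(s−1) = ((p−1)^s + (−1)^(s−1))/p ≠ 0; elementary for s = 2: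
H_1 = y_2 Q, H_2 = −y_1 Q, deg Q = p − 2 ≥ 1). [difficulty: provable-now] -/
@[route_item "route-ResolutionOfSingularities-WildCones"]
def ChernCriticalDirection : Prop :=
  ∀ p : ℕ, p.Prime → p ≠ 2 → ∀ (s : ℕ), 2 ≤ s → ∀ (k : Type) [Field k] [CharP k p] [IsAlgClosed k] (H : MvPolynomial (Fin s) k), H.IsHomogeneous p → H ≠ 0 → ∃ v : Fin s → k, v ≠ 0 ∧ ∀ j : Fin s, MvPolynomial.eval v (MvPolynomial.pderiv j H) = 0

-- `ChernCriticalDirection` holds: proved by `Summit.ResolutionOfSingularities.ResolutionOfSingularities.Theorems.WildConesConeExit.chernCriticalDirection_proof` @ ba4428222d8d (its module imports this route file, so no `_holds` link can be stated here).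

/-- item stmt-ResolutionOfSingularities-16886 · assembly · rank 1 · closed · proved by Summit.ResolutionOfSingularities.ResolutionOfSingularities.Theorems.WildCones.assembly_proof (prover) · by planner
sources: arXiv:1802.05010, Lipman1978
[assembly] ConeExit → NarrowRunsDie → ClassicalRegimes → IsolatedForcedTermination (the engine;
closable at once by the glue's `engine`). -/
@[route_item "route-ResolutionOfSingularities-WildCones"]
def Assembly : Prop :=
  ConeExit → NarrowRunsDie → ClassicalRegimes → IsolatedForcedTermination

-- `Assembly` holds: proved by `Summit.ResolutionOfSingularities.ResolutionOfSingularities.Theorems.WildCones.assembly_proof` (its module imports this route file, so no `_holds` link can be stated here).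

/-! D-0027 §2.1 — DECIDING THEOREM (planner-authored via `route open/edit --closes-file`; by planner-plan-novel-ResolutionOfSingularities-Re-dc19aa3a-c-v 2026-08-16T21:27:54Z):
its hypotheses are this route's items and its conclusion the sub-problem Statement (glue_lint), and it elaborates with this file. -/

@[closes "route-ResolutionOfSingularities-WildCones"] theorem closes (hN : NarrowRunsDie) (hC : ConeExit) (hS : Steer) (hR : ClassicalRegimes)
    (hP : PatchingRelPerfect) (hT : TorsorToLurelPerfect) (hD : DescentPerfectToAll) :
    _root_.ResolutionOfSingularities :=
  have hI : IsolatedForcedTermination := fun p hp n hn κ _ _ _ c₀ i t =>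
    if h : n ≤ 2 ∨ p = 2 then hR p hp n hn h κ c₀ i t
    else fun hall =>
      hN p hp (fun h2 => h (Or.inr h2)) n (by omega) κ c₀ i t hall
        (fun m => hC p hp (fun h2 => h (Or.inr h2)) n (by omega) κ _ (i m) (t m)
          (hall m).1 (hall m).2 (hall (m + 1)).1 (hall (m + 1)).2)
  fun p hp => hD p hp (hP p hp (hT p hp (hS hI p hp)))

end Summit.ResolutionOfSingularities.ResolutionOfSingularities.Theses.WildCones
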